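import Literature.NumberTheory.EllipticCurves.SteinWuthrich2013.NonsplitIntegralIsoProofs
import Literature.NumberTheory.EllipticCurves.TateCurve.OneUnitParameter
import HarnessLib

/-!
# Stein–Wuthrich 2013 §4.2 at a NON-split prime: one-unit Tate parameters in `ℂ_p` of the
# rational points of `E₁(ℚ_p)` (Silverman ATAEC §V.4, V.5.3; proofs only)

Topic `Literature/NumberTheory/EllipticCurves` (cluster `SteinWuthrich2013`); proof file. Cell
`bsd-eis`, seat `bsd-eis-k5-c4` g3: step N3b of the discharge of the named fact
`SteinWuthrich2013.exists_isMultCanonical` (conjunct `hHn` of `stub_publishedFacts`, crux 4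
`BSDpOnCellC`, stmt-BirchSwinnertonDyer-19034). This is the `ℂ_p`-analogue of
`SplitUniformizationDataProofs.exists_splitUniformizationData`: at a non-split multiplicative prime the
Tate uniformisation `E_q(ℂ_p) ≅ ℂ_p^*/q^ℤ` is only defined over the unramified quadratic extension,
and we work in `ℂ_p` (Mathlib `PadicComplex`), where the integral isomorphism
`C • (W ⊗ ℂ_p) = E_q` exists (`exists_integral_variableChange_padicComplex`).

* `toComplexPoint_some` — the point map `E(ℚ_p) → E(ℂ_p)` on coordinates;
* `exists_oneUnit_tate_eq_padicComplex` — every rational point of `E₁(ℚ_p)` has a Tate parameter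
  `1 + t ∈ ℂ_p`, `0 < ‖t‖ ≤ p⁻¹`;
* `exists_nonsplitUniformizationData` — **the data `(C, υ)` over `ℂ_p`**: `C • (W ⊗ ℂ_p) = E_q`
  integral, `υ(P) ∈ ℂ_p` one-units (`‖υ(P) − 1‖ ≤ p⁻¹`, `υ(P) ≠ 1`, `υ(P) ∉ q^ℤ`) with
  `(X(υ(P)), Y(υ(P))) = (C.toX x, C.toY x y)` and `υ(P ± Q) = υ(P)υ(Q)^{±1}` — the hypotheses
  `hυ0`, `hυX`, `hυadd`, `hυsub` of `tateSigma_theta_of_uniformization` over `K = ℂ_p`.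

## Sources
* J. H. Silverman, *Advanced Topics in the Arithmetic of Elliptic Curves* (1994), Thm. V.3.1 (c),
  §V.4, Thm. V.5.3 (PDF pp. 395–409). [SilvermanATAEC1994]
* W. Stein, C. Wuthrich, Math. Comp. 82 (2013), §4.2. [SteinWuthrich2013]
-/

noncomputable section

open scoped Classical

open WeierstrassCurve Literature.NumberTheory.EllipticCurves
  Literature.NumberTheory.EllipticCurves.TateCurve Literature.NumberTheory.LocalFields

namespace Literature.NumberTheory.EllipticCurves.SteinWuthrich2013

variable {W : WeierstrassCurve ℚ} {p : ℕ} [hp : Fact p.Prime]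

/-! ### The point map `E(ℚ_p) → E(ℂ_p)` -/

/-- `‖(x : ℂ_p)‖ = ‖x‖_p`. [folklore] -/
private theorem norm_ι (x : ℚ_[p]) : ‖algebraMap ℚ_[p] ℂ_[p] x‖ = ‖x‖ := norm_algebraMap' ℂ_[p] x

/-- A `ℚ_p`-point gives the `ℂ_p`-point with the embedded coordinates. [folklore]
[cite: SilvermanATAEC1994, Thm. V.3.1 (c) (PDF p. 395)] -/
theorem nonsingular_algebraMap_padicComplex {E₀ : WeierstrassCurve ℚ_[p]} {x y : ℚ_[p]}
    (h : E₀.toAffine.Nonsingular x y) :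
    (E₀.map (algebraMap ℚ_[p] ℂ_[p])).toAffine.Nonsingular (algebraMap ℚ_[p] ℂ_[p] x)
      (algebraMap ℚ_[p] ℂ_[p] y) :=
  (Affine.map_nonsingular _ (algebraMap ℚ_[p] ℂ_[p]).injective x y).mpr h

/-- The point map `E(ℚ_p) → E(ℂ_p)` (Mathlib `Affine.Point.map` along `ℚ_p → ℂ_p`) on coordinates.
[folklore] [cite: SilvermanATAEC1994, Thm. V.3.1 (c) (PDF p. 395)] -/
theorem toComplexPoint_some (E₀ : WeierstrassCurve ℚ_[p]) {x y : ℚ_[p]}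
    (h : E₀.toAffine.Nonsingular x y) :
    Affine.Point.map (W' := E₀.toAffine) (S := ℚ_[p]) (Algebra.ofId ℚ_[p] ℂ_[p]) (.some x y h) =
      (.some (algebraMap ℚ_[p] ℂ_[p] x) (algebraMap ℚ_[p] ℂ_[p] y)
        (nonsingular_algebraMap_padicComplex h) : (E₀.map (algebraMap ℚ_[p] ℂ_[p])).toAffine.Point) :=
  Affine.Point.map_some (W' := E₀.toAffine) (F := ℚ_[p]) (Algebra.ofId ℚ_[p] ℂ_[p]) h

/-! ### One-unit Tate parameters in `ℂ_p` -/

/-- **Every rational point of `E₁(ℚ_p)` has a one-unit Tate parameter in `ℂ_p`**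
(ATAEC §V.4, `φ(1 + 𝔪) = E_{q,1}`, tree `TateCurve.exists_tate_eq_of_one_lt_norm` over `K = ℂ_p`):
for `C` integral with `C • (W ⊗ ℂ_p) = E_q` and a `ℚ_p`-point `(x,y)` of `W ⊗ ℚ_p` with `‖x‖ > 1`
there is `t ∈ ℂ_p`, `t ≠ 0`, `‖t‖ ≤ p⁻¹`, with `(X(1+t), Y(1+t)) = (C.toX x, C.toY x y)`
(`‖t‖² = ‖X‖⁻¹ = ‖x‖_p⁻¹ ≤ p⁻²`). [cite: SilvermanATAEC1994, §V.4 (PDF p. 401)] -/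
theorem exists_oneUnit_tate_eq_padicComplex {E₀ : WeierstrassCurve ℚ_[p]} [E₀.IsIntegral ℤ_[p]]
    {q : ℚ_[p]} (hq0 : q ≠ 0) (hq : ‖q‖ < 1) {C : VariableChange ℂ_[p]}
    (hC : C • E₀.map (algebraMap ℚ_[p] ℂ_[p]) = tateCurve (algebraMap ℚ_[p] ℂ_[p] q))
    (hu : ‖(C.u : ℂ_[p])‖ = 1) (hr : ‖C.r‖ ≤ 1) {x y : ℚ_[p]} (h : E₀.toAffine.Nonsingular x y)
    (hx : 1 < ‖x‖) :
    ∃ t : ℂ_[p], t ≠ 0 ∧ ‖t‖ ≤ (p : ℝ)⁻¹ ∧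
      tateX (algebraMap ℚ_[p] ℂ_[p] q) (1 + t) = C.toX (algebraMap ℚ_[p] ℂ_[p] x) ∧
      tateY (algebraMap ℚ_[p] ℂ_[p] q) (1 + t) =
        C.toY (algebraMap ℚ_[p] ℂ_[p] x) (algebraMap ℚ_[p] ℂ_[p] y) := by
  set ι := algebraMap ℚ_[p] ℂ_[p]
  have hq' : ‖ι q‖ < 1 := by rw [norm_ι]; exact hq
  have hq0' : ι q ≠ 0 := (map_ne_zero _).mpr hq0
  have hns := nonsingular_algebraMap_padicComplex h
  have hns' : (tateCurve (ι q)).toAffine.Nonsingular (C.toX (ι x)) (C.toY (ι x) (ι y)) := by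
    rw [← hC]; exact (VariableChange.nonsingular_iff _ C _ _).mpr hns
  have heq : C.toY (ι x) (ι y) ^ 2 + C.toX (ι x) * C.toY (ι x) (ι y) =
      C.toX (ι x) ^ 3 + tateA4 (ι q) * C.toX (ι x) + tateA6 (ι q) := by
    have h1 := hns'.1
    rw [WeierstrassCurve.Affine.equation_iff] at h1
    simp only [tateCurve] at h1
    linear_combination h1
  have honCurve : ∀ u : ℂ_[p], ‖u‖ = 1 → u ≠ 1 →
      tateY (ι q) u ^ 2 + tateX (ι q) u * tateY (ι q) u =
        tateX (ι q) u ^ 3 + tateA4 (ι q) * tateX (ι q) u + tateA6 (ι q) := by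
    intro u hu1 hne
    have hu0 : u ≠ 0 := by intro h0; rw [h0, norm_zero] at hu1; exact zero_ne_one hu1
    exact tate_onCurve' hq0' hq' (Units.mk0 u hu0) (ne_zpow_of_norm_eq_one hq' hu1 hne)
  have hx' : 1 < ‖ι x‖ := by rw [norm_ι]; exact hx
  obtain ⟨t, ht0, ht1, hX, hY⟩ :=
    exists_tate_eq_of_one_lt_norm (by norm_num) hq' honCurve heq (one_lt_norm_toX' hu hr hx')
  refine ⟨t, ht0, ?_, hX, hY⟩
  -- `‖t‖² = ‖X(1+t)‖⁻¹ = ‖x‖⁻¹ ≤ p⁻²`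
  have hXn : ‖tateX (ι q) (1 + t)‖ = (‖t‖ ^ 2)⁻¹ := by
    have hu1 : ‖(1 : ℂ_[p]) + t‖ = 1 := by
      have := IsUltrametricDist.norm_add_eq_max_of_norm_ne_norm (x := (1 : ℂ_[p])) (y := t)
        (by rw [norm_one]; exact ht1.ne')
      rw [this, norm_one, max_eq_left ht1.le]
    have hpr : ‖((1 : ℂ_[p]) + t) / t ^ 2‖ = (‖t‖ ^ 2)⁻¹ := by
      rw [norm_div, hu1, norm_pow, one_div]
    have htpos : 0 < ‖t‖ := norm_pos_iff.mpr ht0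
    have hbig : 1 < ‖((1 : ℂ_[p]) + t) / t ^ 2‖ := by
      rw [hpr]
      exact one_lt_inv_iff₀.mpr ⟨pow_pos htpos 2, pow_lt_one₀ htpos.le ht1 two_ne_zero⟩
    have hne : ‖((1 : ℂ_[p]) + t) / t ^ 2‖ ≠ ‖tateX (ι q) (1 + t) - (1 + t) / t ^ 2‖ :=
      (((norm_tateX_one_add_sub_le hq' ht1).trans hq'.le).trans_lt hbig).ne'
    have e : tateX (ι q) (1 + t) = (1 + t) / t ^ 2 + (tateX (ι q) (1 + t) - (1 + t) / t ^ 2) := by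
      ring
    rw [e, IsUltrametricDist.norm_add_eq_max_of_norm_ne_norm hne, max_eq_left, hpr]
    exact (((norm_tateX_one_add_sub_le hq' ht1).trans hq'.le).trans hbig.le)
  have hxX : ‖tateX (ι q) (1 + t)‖ = ‖x‖ := by
    rw [hX, VariableChange.toX_def, norm_mul, norm_pow, Units.val_inv_eq_inv_val, norm_inv, hu,
      inv_one, one_pow, one_mul]
    have hne : ‖ι x‖ ≠ ‖-C.r‖ := by rw [norm_neg]; exact (hr.trans_lt hx').ne'
    rw [sub_eq_add_neg, IsUltrametricDist.norm_add_eq_max_of_norm_ne_norm hne,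
      max_eq_left (by rw [norm_neg]; exact hr.trans hx'.le), norm_ι]
  have hp0 : (0 : ℝ) < p := by exact_mod_cast hp.out.pos
  have hp1 : (1 : ℝ) < p := by exact_mod_cast hp.out.one_lt
  -- `‖x‖ = p^{2k}` with `k ≥ 1`: `3 v(x) = 2 v(y)` on the integral equation
  have hx2 : (p : ℝ) ^ 2 ≤ ‖x‖ := by
    obtain ⟨hsq, hxy⟩ := E₀.norm_sq_eq_norm_cube h.1 hx
    have hx0 : x ≠ 0 := by intro h0; rw [h0, norm_zero] at hx; exact absurd hx (by norm_num)
    have hy0 : y ≠ 0 := by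
      intro h0; rw [h0, norm_zero] at hxy; exact absurd hxy (not_lt.mpr (norm_nonneg _))
    rw [Padic.norm_eq_zpow_neg_valuation hx0] at hsq hx ⊢
    rw [Padic.norm_eq_zpow_neg_valuation hy0] at hsq
    rw [← zpow_natCast, ← zpow_mul, ← zpow_natCast, ← zpow_mul] at hsq
    have hinj := zpow_right_injective₀ hp0 hp1.ne' hsq
    have hvx : x.valuation < 0 := by
      by_contra hle
      push Not at hle
      have : (p : ℝ) ^ (-x.valuation) ≤ 1 := zpow_le_one_of_nonpos₀ hp1.le (by omega)
      exact absurd hx (not_lt.mpr this)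
    have h2 : (2 : ℤ) ≤ -x.valuation := by push_cast at hinj; omega
    rw [← zpow_natCast]
    exact zpow_le_zpow_right₀ hp1.le (by exact_mod_cast h2)
  have ht2 : ‖t‖ ^ 2 ≤ ((p : ℝ)⁻¹) ^ 2 := by
    have h1 : ‖t‖ ^ 2 = ‖x‖⁻¹ := by
      have := hXn.symm.trans hxX
      rw [← this, inv_inv]
    rw [h1, inv_pow]
    exact inv_anti₀ (pow_pos hp0 2) hx2
  exact (pow_le_pow_iff_left₀ (norm_nonneg _) (inv_nonneg.mpr hp0.le) two_ne_zero).mp ht2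

/-- **The uniformisation data at a NON-split multiplicative prime `p ≠ 2`, over `ℂ_p`.** For `W/ℚ`
globally minimal with multiplicative reduction at `p`, `q ∈ ℚ_p` with `0 < ‖q‖ < 1` and
`tateJ q = j(W)`: there are an integral `C = (u,r,s,t)` over `ℂ_p` with `C • (W ⊗ ℂ_p) = E_q`,
`‖u‖ = 1`, `‖r‖, ‖s‖, ‖t‖ ≤ 1`, and one-unit parameters `υ(P) ∈ ℂ_p` (`‖υ(P) − 1‖ ≤ p⁻¹`,
`υ(P) ≠ 1`, `υ(P) ∉ q^ℤ`) of the rational points `P = (x,y)` of `E₁(ℚ_p)` with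
`(X(υ(P)), Y(υ(P))) = (C.toX x, C.toY x y)`, `υ(P+Q) = υ(P)υ(Q)`, `υ(P−Q) = υ(P)υ(Q)⁻¹`
(Silverman ATAEC V.3.1 (c), §V.4, V.5.3 over the quadratic unramified extension, here inside `ℂ_p`;
SW 2013 §4.2). [cite: SilvermanATAEC1994, Thm. V.3.1 (c) and Thm. V.5.3 (PDF pp. 395–409)]
[cite: SteinWuthrich2013, §4.2 (p. 15)] -/
theorem exists_nonsplitUniformizationData [W.IsElliptic] [W.IsGloballyMinimal] (hp2 : p ≠ 2)
    (hmult : W.HasMultiplicativeReductionAtPrime p) {q : ℚ_[p]} (hq0 : q ≠ 0) (hq : ‖q‖ < 1)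
    (hj : tateJ q = (W.j : ℚ_[p])) :
    ∃ (C : VariableChange ℂ_[p]) (υ : ℚ → ℚ → ℂ_[p]),
      C • (W.baseChange ℚ_[p]).map (algebraMap ℚ_[p] ℂ_[p]) = tateCurve (algebraMap ℚ_[p] ℂ_[p] q) ∧
      ‖(C.u : ℂ_[p])‖ = 1 ∧ ‖C.r‖ ≤ 1 ∧ ‖C.s‖ ≤ 1 ∧ ‖C.t‖ ≤ 1 ∧
      (∀ {x y : ℚ} (_ : W.toAffine.Nonsingular x y), 1 < ‖(x : ℚ_[p])‖ →
        υ x y ≠ 0 ∧ ‖υ x y - 1‖ ≤ (p : ℝ)⁻¹ ∧ υ x y ≠ 1 ∧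
          (∀ n : ℤ, υ x y ≠ algebraMap ℚ_[p] ℂ_[p] q ^ n) ∧
          tateX (algebraMap ℚ_[p] ℂ_[p] q) (υ x y) =
            C.toX (algebraMap ℚ_[p] ℂ_[p] (x : ℚ_[p])) ∧
          tateY (algebraMap ℚ_[p] ℂ_[p] q) (υ x y) =
            C.toY (algebraMap ℚ_[p] ℂ_[p] (x : ℚ_[p])) (algebraMap ℚ_[p] ℂ_[p] (y : ℚ_[p]))) ∧
      (∀ {x₁ y₁ x₂ y₂ x₃ y₃ : ℚ} (h₁ : W.toAffine.Nonsingular x₁ y₁)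
        (h₂ : W.toAffine.Nonsingular x₂ y₂) (h₃ : W.toAffine.Nonsingular x₃ y₃),
        1 < ‖(x₁ : ℚ_[p])‖ → 1 < ‖(x₂ : ℚ_[p])‖ →
        (.some x₁ y₁ h₁ : W.toAffine.Point) + .some x₂ y₂ h₂ = .some x₃ y₃ h₃ →
          υ x₃ y₃ = υ x₁ y₁ * υ x₂ y₂) ∧
      (∀ {x₁ y₁ x₂ y₂ x₄ y₄ : ℚ} (h₁ : W.toAffine.Nonsingular x₁ y₁)
        (h₂ : W.toAffine.Nonsingular x₂ y₂) (h₄ : W.toAffine.Nonsingular x₄ y₄),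
        1 < ‖(x₁ : ℚ_[p])‖ → 1 < ‖(x₂ : ℚ_[p])‖ →
        (.some x₁ y₁ h₁ : W.toAffine.Point) - .some x₂ y₂ h₂ = .some x₄ y₄ h₄ →
          υ x₄ y₄ = υ x₁ y₁ * (υ x₂ y₂)⁻¹) := by
  set ι := algebraMap ℚ_[p] ℂ_[p] with hι
  have hp0 : (0 : ℝ) < p := by exact_mod_cast hp.out.pos
  have hpinv1 : (p : ℝ)⁻¹ < 1 := inv_lt_one_of_one_lt₀ (by exact_mod_cast hp.out.one_lt)
  have hq' : ‖ι q‖ < 1 := by rw [norm_ι]; exact hq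
  have hq0' : ι q ≠ 0 := (map_ne_zero _).mpr hq0
  obtain ⟨C, hC, hu, hr, hs, ht⟩ := exists_integral_variableChange_padicComplex hp2 hmult hq0 hq hj
  set E₀ : WeierstrassCurve ℚ_[p] := W.baseChange ℚ_[p] with hE₀
  haveI : E₀.IsIntegral ℤ_[p] := by rw [hE₀]; infer_instance
  set E : WeierstrassCurve ℂ_[p] := E₀.map ι with hE
  set T : WeierstrassCurve ℂ_[p] := C • E with hT
  set toC := Affine.Point.map (W' := E₀.toAffine) (S := ℚ_[p]) (Algebra.ofId ℚ_[p] ℂ_[p]) with htoC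
  -- the parameters
  have key := fun (x y : ℚ) (h : W.toAffine.Nonsingular x y) (hx : 1 < ‖(x : ℚ_[p])‖) =>
    exists_oneUnit_tate_eq_padicComplex hq0 hq hC hu hr (nonsingular_ratCast h) hx
  choose tfun htfun using key
  let υ : ℚ → ℚ → ℂ_[p] := fun x y =>
    if hh : ∃ h : W.toAffine.Nonsingular x y, 1 < ‖(x : ℚ_[p])‖ then 1 + tfun x y hh.1 hh.2 else 1
  have hυ : ∀ {x y : ℚ} (h : W.toAffine.Nonsingular x y), 1 < ‖(x : ℚ_[p])‖ →
      υ x y ≠ 0 ∧ ‖υ x y - 1‖ ≤ (p : ℝ)⁻¹ ∧ υ x y ≠ 1 ∧ (∀ n : ℤ, υ x y ≠ ι q ^ n) ∧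
        tateX (ι q) (υ x y) = C.toX (ι (x : ℚ_[p])) ∧
        tateY (ι q) (υ x y) = C.toY (ι (x : ℚ_[p])) (ι (y : ℚ_[p])) := by
    intro x y h hx
    have hh : ∃ h : W.toAffine.Nonsingular x y, 1 < ‖(x : ℚ_[p])‖ := ⟨h, hx⟩
    have hυxy : υ x y = 1 + tfun x y hh.1 hh.2 := dif_pos hh
    obtain ⟨ht0, ht1, hX, hY⟩ := htfun x y hh.1 hh.2
    have hnorm1 : ‖υ x y - 1‖ ≤ (p : ℝ)⁻¹ := by rw [hυxy, add_sub_cancel_left]; exact ht1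
    have hnorm1' : ‖υ x y - 1‖ < 1 := hnorm1.trans_lt hpinv1
    have hnorm : ‖υ x y‖ = 1 := norm_eq_one_of_norm_sub_one_lt hnorm1'
    have hne1 : υ x y ≠ 1 := by
      rw [hυxy]; intro h1; exact ht0 (by linear_combination h1)
    refine ⟨fun h0 => by rw [h0, norm_zero] at hnorm; exact zero_ne_one hnorm, hnorm1, hne1,
      fun n => ne_zpow_of_norm_eq_one hq' hnorm hne1 n, ?_, ?_⟩
    · rw [hυxy]; exact hX
    · rw [hυxy]; exact hY
  refine ⟨C, υ, hC, hu, hr, hs, ht, hυ, ?_, ?_⟩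
  · -- multiplicativity
    intro x₁ y₁ x₂ y₂ x₃ y₃ h₁ h₂ h₃ hx₁ hx₂ hS
    obtain ⟨h0₁, hn₁, -, hq₁, hX₁, hY₁⟩ := hυ h₁ hx₁
    obtain ⟨h0₂, hn₂, -, hq₂, hX₂, hY₂⟩ := hυ h₂ hx₂
    have hx₃ : 1 < ‖(x₃ : ℚ_[p])‖ := by
      have hk := E₀.isInReductionKernel_add
        (P := W.toPadicPoint p (.some x₁ y₁ h₁)) (Q := W.toPadicPoint p (.some x₂ y₂ h₂))
        (by rw [toPadicPoint_some]; exact hx₁) (by rw [toPadicPoint_some]; exact hx₂)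
      rw [← map_add, hS, toPadicPoint_some] at hk
      exact hk
    obtain ⟨h0₃, hn₃, -, hq₃, hX₃, hY₃⟩ := hυ h₃ hx₃
    have hT₁ : T.toAffine.Nonsingular (C.toX (ι x₁)) (C.toY (ι x₁) (ι y₁)) :=
      (VariableChange.nonsingular_iff _ C _ _).mpr
        (nonsingular_algebraMap_padicComplex (nonsingular_ratCast h₁))
    have hT₂ : T.toAffine.Nonsingular (C.toX (ι x₂)) (C.toY (ι x₂) (ι y₂)) :=
      (VariableChange.nonsingular_iff _ C _ _).mpr
        (nonsingular_algebraMap_padicComplex (nonsingular_ratCast h₂))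
    have hT₃ : T.toAffine.Nonsingular (C.toX (ι x₃)) (C.toY (ι x₃) (ι y₃)) :=
      (VariableChange.nonsingular_iff _ C _ _).mpr
        (nonsingular_algebraMap_padicComplex (nonsingular_ratCast h₃))
    have hST : (.some _ _ hT₁ : T.toAffine.Point) + .some _ _ hT₂ = .some _ _ hT₃ := by
      have hsum := map_add ((VariableChange.pointEquiv E C).toAddMonoidHom.comp toC)
        (W.toPadicPoint p (.some x₁ y₁ h₁)) (W.toPadicPoint p (.some x₂ y₂ h₂))
      rw [← map_add, hS, toPadicPoint_some, toPadicPoint_some, toPadicPoint_some] at hsum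
      exact hsum.symm
    obtain ⟨hq₁₂, hX₁₂, hY₁₂⟩ := TateCurve.tate_coords_add hq0' hq' T hC (u := Units.mk0 _ h0₁)
      (v := Units.mk0 _ h0₂) hq₁ hq₂ hT₁ hT₂ hT₃ hX₁ hY₁ hX₂ hY₂ hST
    have hn₁' : ‖υ x₁ y₁ - 1‖ < 1 := hn₁.trans_lt hpinv1
    have hn₂' : ‖υ x₂ y₂ - 1‖ < 1 := hn₂.trans_lt hpinv1
    have hn₃' : ‖υ x₃ y₃ - 1‖ < 1 := hn₃.trans_lt hpinv1
    have huniq := TateCurve.oneUnit_eq_of_tate_eq hq0' hq' (u := Units.mk0 _ h0₃)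
      (u' := Units.mk0 _ h0₁ * Units.mk0 _ h0₂) hn₃' (by
        rw [Units.val_mul, Units.val_mk0, Units.val_mk0]
        exact norm_mul_sub_one_lt' hn₁' hn₂')
      hq₃ hq₁₂ (by rw [Units.val_mk0, hX₃, hX₁₂]) (by rw [Units.val_mk0, hY₃, hY₁₂])
    have := congrArg (fun w : ℂ_[p]ˣ => (w : ℂ_[p])) huniq
    simpa only [Units.val_mul, Units.val_mk0] using this
  · -- the difference
    intro x₁ y₁ x₂ y₂ x₄ y₄ h₁ h₂ h₄ hx₁ hx₂ hD
    obtain ⟨h0₁, hn₁, -, hq₁, hX₁, hY₁⟩ := hυ h₁ hx₁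
    obtain ⟨h0₂, hn₂, -, hq₂, hX₂, hY₂⟩ := hυ h₂ hx₂
    have hx₄ : 1 < ‖(x₄ : ℚ_[p])‖ := by
      have hk := E₀.isInReductionKernel_add
        (P := W.toPadicPoint p (.some x₁ y₁ h₁)) (Q := W.toPadicPoint p (-(.some x₂ y₂ h₂)))
        (by rw [toPadicPoint_some]; exact hx₁)
        (by rw [map_neg, toPadicPoint_some, Affine.Point.neg_some]; exact hx₂)
      rw [← map_add, ← sub_eq_add_neg, hD, toPadicPoint_some] at hk
      exact hk
    obtain ⟨h0₄, hn₄, -, hq₄, hX₄, hY₄⟩ := hυ h₄ hx₄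
    have hT₁ : T.toAffine.Nonsingular (C.toX (ι x₁)) (C.toY (ι x₁) (ι y₁)) :=
      (VariableChange.nonsingular_iff _ C _ _).mpr
        (nonsingular_algebraMap_padicComplex (nonsingular_ratCast h₁))
    have hT₂ : T.toAffine.Nonsingular (C.toX (ι x₂)) (C.toY (ι x₂) (ι y₂)) :=
      (VariableChange.nonsingular_iff _ C _ _).mpr
        (nonsingular_algebraMap_padicComplex (nonsingular_ratCast h₂))
    have hT₂' : T.toAffine.Nonsingular (C.toX (ι x₂))
        (T.toAffine.negY (C.toX (ι x₂)) (C.toY (ι x₂) (ι y₂))) :=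
      (Affine.nonsingular_neg _ _).mpr hT₂
    have hT₄ : T.toAffine.Nonsingular (C.toX (ι x₄)) (C.toY (ι x₄) (ι y₄)) :=
      (VariableChange.nonsingular_iff _ C _ _).mpr
        (nonsingular_algebraMap_padicComplex (nonsingular_ratCast h₄))
    have hN : -(.some _ _ hT₂ : T.toAffine.Point) = .some _ _ hT₂' := Affine.Point.neg_some hT₂
    obtain ⟨hq₂', hX₂', hY₂'⟩ := TateCurve.tate_coords_neg hq0' hq' T hC (u := Units.mk0 _ h0₂) hq₂ hT₂ hT₂'
      hX₂ hY₂ hN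
    have hST : (.some _ _ hT₁ : T.toAffine.Point) + .some _ _ hT₂' = .some _ _ hT₄ := by
      have hsum := map_add ((VariableChange.pointEquiv E C).toAddMonoidHom.comp toC)
        (W.toPadicPoint p (.some x₁ y₁ h₁)) (W.toPadicPoint p (-(.some x₂ y₂ h₂)))
      rw [← map_add, ← sub_eq_add_neg, hD, map_neg, map_neg, toPadicPoint_some, toPadicPoint_some,
        toPadicPoint_some] at hsum
      exact hsum.symm
    obtain ⟨hq₁₂, hX₁₂, hY₁₂⟩ := TateCurve.tate_coords_add hq0' hq' T hC (u := Units.mk0 _ h0₁)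
      (v := (Units.mk0 _ h0₂)⁻¹) hq₁ hq₂' hT₁ hT₂' hT₄ hX₁ hY₁ hX₂' hY₂' hST
    have hn₁' : ‖υ x₁ y₁ - 1‖ < 1 := hn₁.trans_lt hpinv1
    have hn₂' : ‖υ x₂ y₂ - 1‖ < 1 := hn₂.trans_lt hpinv1
    have hn₄' : ‖υ x₄ y₄ - 1‖ < 1 := hn₄.trans_lt hpinv1
    have hn₂i : ‖(υ x₂ y₂)⁻¹ - 1‖ < 1 := by
      have hn2 : ‖υ x₂ y₂‖ = 1 := norm_eq_one_of_norm_sub_one_lt hn₂'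
      have e : (υ x₂ y₂)⁻¹ - 1 = -((υ x₂ y₂)⁻¹ * (υ x₂ y₂ - 1)) := by field_simp; ring
      rw [e, norm_neg, norm_mul, norm_inv, hn2, inv_one, one_mul]
      exact hn₂'
    have huniq := TateCurve.oneUnit_eq_of_tate_eq hq0' hq' (u := Units.mk0 _ h0₄)
      (u' := Units.mk0 _ h0₁ * (Units.mk0 _ h0₂)⁻¹) hn₄' (by
        rw [Units.val_mul, Units.val_inv_eq_inv_val, Units.val_mk0, Units.val_mk0]
        exact norm_mul_sub_one_lt' hn₁' hn₂i)
      hq₄ hq₁₂ (by rw [Units.val_mk0, hX₄, hX₁₂]) (by rw [Units.val_mk0, hY₄, hY₁₂])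
    have := congrArg (fun w : ℂ_[p]ˣ => (w : ℂ_[p])) huniq
    simpa only [Units.val_mul, Units.val_inv_eq_inv_val, Units.val_mk0] using this

end Literature.NumberTheory.EllipticCurves.SteinWuthrich2013

end
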